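import Summits.AtomisticToContinuum.Crystallization.Theorems.SlackRigidity.Negative.WitnessBasics
import Literature.MathematicalPhysics.StatisticalMechanics.LennardJonesClusters
import HarnessLib

/-!
# Line `ekeland-surgery-parity` (crux `SlackRigidity`, stmt-AtomisticToContinuum-11960): bad counts move by `O(Hamming distance)`

Stub `stub_badCountTransfer` (E3 of the Hamming–Ekeland regularisation) of the line skeleton: for a
periodic template `P`, radius `R > 0`, tolerance `ε > 0` and hard core `δ > 0` there is
`C = 1 + 2·(2(R+ε)/δ + 1)³` such that for two labelled configurations `x, x' : Fin N → ℝ³` with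
`x'` `δ`-separated,
`#{i : ¬Good(x, i)} ≤ #{i : ¬Good(x', i)} + C · #{i : x' i ≠ x i}`
at the SAME radius and tolerance.

Proof.  Let `D = {i : x' i ≠ x i}` (changed labels).  An unchanged label `i` that is `(R, ε)`-good in
`x'` (isometry `A`) and has no changed label `j` with `|x' i − x' j| ≤ R + ε` (new positions) nor
with `|x' i − x j| ≤ R` (old positions) is `(R, ε)`-good in `x` with the same `A`: the template points
of norm `≤ R` are matched in `x'` by particles within `R + ε` of `x' i = x i`, hence by unchanged
particles, and the particles of `x` within `R` of `x i` are unchanged, hence matched in `x'`.  So the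
bad set of `x` is covered by the bad set of `x'`, `D`, and the two families of neighbourhoods of
changed labels; each neighbourhood contains at most `(2(R+ε)/δ + 1)³` labels by the volume packing
bound `card_le_of_separated_of_dist_le` applied to the `δ`-separated points `x'`.  All `[folklore]`.
-/

noncomputable section

namespace Summit.AtomisticToContinuum.Crystallization.Theorems.EkelandBadCountTransfer

open scoped BigOperators
open Literature.MathematicalPhysics.StatisticalMechanics
open Summit.AtomisticToContinuum.Crystallization.Theorems.SlackRigidityNegative
  (E3 Good badCount dist_add_linearIsometry)

/-- **Packing fibre bound.** In a `δ`-separated labelled configuration `x'` of `ℝ³`, at most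
`(2r/δ + 1)³` labels carry a point within distance `r` of a given centre `c`. [folklore] -/
theorem card_filter_dist_le {N : ℕ} {x' : Fin N → E3} {δ : ℝ} (hδ : 0 < δ)
    (hsep : ∀ i j : Fin N, i ≠ j → δ ≤ dist (x' i) (x' j)) (c : E3) {r : ℝ} (hr : 0 ≤ r) :
    ((Finset.univ.filter fun i : Fin N => dist (x' i) c ≤ r).card : ℝ) ≤ (2 * r / δ + 1) ^ 3 := by
  classical
  set S := Finset.univ.filter fun i : Fin N => dist (x' i) c ≤ r with hS
  have hinj : Function.Injective x' := by
    intro i j hij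
    by_contra hne
    have h := hsep i j hne
    rw [hij, dist_self] at h
    linarith
  have hcard : ((S.image x').card : ℝ) = S.card := by rw [Finset.card_image_of_injective _ hinj]
  rw [← hcard]
  have h := card_le_of_separated_of_dist_le (S.image x') c hδ hr ?_ ?_
  · rw [finrank_euclideanSpace_fin] at h
    exact h
  · intro q hq
    obtain ⟨i, hi, rfl⟩ := Finset.mem_image.1 hq
    exact (Finset.mem_filter.1 hi).2
  · intro q hq q' hq' hne
    obtain ⟨i, hi, rfl⟩ := Finset.mem_image.1 hq
    obtain ⟨j, hj, rfl⟩ := Finset.mem_image.1 hq'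
    exact hsep i j fun h => hne (by rw [h])

/-- **Goodness survives relabelled surgery away from the changed particles.** If `x' i = x i`, the
label `i` is `(R, ε)`-good in `x'`, every changed label `j` (`x' j ≠ x j`) has its new position
farther than `R + ε` and its old position farther than `R` from `x' i`, then `i` is `(R, ε)`-good
in `x` (same isometry). [folklore] -/
theorem good_of_good_unchanged {P : PeriodicConfiguration 3} {R ε : ℝ} {N : ℕ}
    {x x' : Fin N → E3} {i : Fin N} (hxi : x' i = x i) (hgood : Good P R ε x' i)
    (hfar₁ : ∀ j : Fin N, x' j ≠ x j → R + ε < dist (x' i) (x' j))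
    (hfar₂ : ∀ j : Fin N, x' j ≠ x j → R < dist (x' i) (x j)) : Good P R ε x i := by
  obtain ⟨A, hA1, hA2⟩ := hgood
  refine ⟨A, fun p hp hpR => ?_, fun j hj => ?_⟩
  · obtain ⟨j, hj⟩ := hA1 p hp hpR
    by_cases hjD : x' j = x j
    · exact ⟨j, by rw [← hjD, ← hxi]; exact hj⟩
    · exfalso
      have h1 : dist (x' i) (x' j) ≤ R + ε := by
        have hAp : dist (x' i + A p) (x' i) = ‖p‖ := dist_add_linearIsometry A (x' i) p
        have htri := dist_triangle (x' j) (x' i + A p) (x' i)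
        rw [dist_comm (x' i) (x' j)]
        linarith
      exact absurd (hfar₁ j hjD) (not_lt.2 h1)
  · by_cases hjD : x' j = x j
    · have hj' : dist (x' j) (x' i) ≤ R := by rw [hjD, hxi]; exact hj
      obtain ⟨p, hp, hjp⟩ := hA2 j hj'
      exact ⟨p, hp, by rw [← hjD, ← hxi]; exact hjp⟩
    · exfalso
      have h1 : dist (x' i) (x j) ≤ R := by rw [hxi, dist_comm]; exact hj
      exact absurd (hfar₂ j hjD) (not_lt.2 h1)

/-- **Stub E3 — bad counts move by `O(Hamming distance)`.** For a `δ`-separated comparison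
configuration `x'` (same labels), `badCount(x) ≤ badCount(x') + C · #{i : x' i ≠ x i}` at the same
radius and tolerance, with `C = 1 + 2·(2(R+ε)/δ + 1)³`. [folklore] -/
theorem stub_badCountTransfer :
    ∀ (P : PeriodicConfiguration 3) (R ε δ : ℝ), 0 < R → 0 < ε → 0 < δ → ∃ C : ℝ, 0 ≤ C ∧
      ∀ (N : ℕ) (x x' : Fin N → E3), (∀ i j : Fin N, i ≠ j → δ ≤ dist (x' i) (x' j)) →
        (badCount P R ε x : ℝ) ≤
          badCount P R ε x' + C * ((Finset.univ.filter fun i => x' i ≠ x i).card : ℝ) := by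
  intro P R ε δ hR hε hδ
  set K : ℝ := (2 * (R + ε) / δ + 1) ^ 3 with hK
  have hK0 : 0 ≤ K := by positivity
  refine ⟨1 + 2 * K, by positivity, fun N x x' hsep => ?_⟩
  classical
  -- changed labels
  set D := Finset.univ.filter fun i : Fin N => x' i ≠ x i with hD
  -- bad sets as filters
  set badX := Finset.univ.filter fun i : Fin N => ¬ Good P R ε x i with hbadX
  set badX' := Finset.univ.filter fun i : Fin N => ¬ Good P R ε x' i with hbadX'
  have e1 : badCount P R ε x = badX.card := by
    unfold badCount
    rw [Nat.card_eq_fintype_card, Fintype.card_subtype]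
  have e2 : badCount P R ε x' = badX'.card := by
    unfold badCount
    rw [Nat.card_eq_fintype_card, Fintype.card_subtype]
  -- neighbourhoods of changed labels (new positions, radius `R + ε`; old positions, radius `R`)
  set U₁ := D.biUnion fun j => Finset.univ.filter fun i : Fin N => dist (x' i) (x' j) ≤ R + ε
    with hU₁
  set U₂ := D.biUnion fun j => Finset.univ.filter fun i : Fin N => dist (x' i) (x j) ≤ R with hU₂
  -- the key inclusion
  have hcover : badX ⊆ badX' ∪ D ∪ U₁ ∪ U₂ := by
    intro i hi
    have hbad : ¬ Good P R ε x i := (Finset.mem_filter.1 hi).2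
    by_contra hcon
    simp only [Finset.mem_union, not_or] at hcon
    obtain ⟨⟨⟨hB', hDi⟩, hU₁i⟩, hU₂i⟩ := hcon
    have hgood' : Good P R ε x' i := by
      by_contra h
      exact hB' (Finset.mem_filter.2 ⟨Finset.mem_univ _, h⟩)
    have hxi : x' i = x i := by
      by_contra h
      exact hDi (Finset.mem_filter.2 ⟨Finset.mem_univ _, h⟩)
    have hfar₁ : ∀ j : Fin N, x' j ≠ x j → R + ε < dist (x' i) (x' j) := fun j hj => by
      by_contra h
      rw [not_lt] at h
      exact hU₁i (Finset.mem_biUnion.2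
        ⟨j, Finset.mem_filter.2 ⟨Finset.mem_univ _, hj⟩, Finset.mem_filter.2 ⟨Finset.mem_univ _, h⟩⟩)
    have hfar₂ : ∀ j : Fin N, x' j ≠ x j → R < dist (x' i) (x j) := fun j hj => by
      by_contra h
      rw [not_lt] at h
      exact hU₂i (Finset.mem_biUnion.2
        ⟨j, Finset.mem_filter.2 ⟨Finset.mem_univ _, hj⟩, Finset.mem_filter.2 ⟨Finset.mem_univ _, h⟩⟩)
    exact hbad (good_of_good_unchanged hxi hgood' hfar₁ hfar₂)
  -- counting the neighbourhoods
  have hU₁card : (U₁.card : ℝ) ≤ D.card * K := by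
    calc (U₁.card : ℝ)
        ≤ ∑ j ∈ D, ((Finset.univ.filter fun i : Fin N => dist (x' i) (x' j) ≤ R + ε).card : ℝ) := by
          exact_mod_cast Finset.card_biUnion_le
      _ ≤ ∑ _j ∈ D, K :=
          Finset.sum_le_sum fun j _ => card_filter_dist_le hδ hsep (x' j) (by linarith)
      _ = D.card * K := by rw [Finset.sum_const, nsmul_eq_mul]
  have hU₂card : (U₂.card : ℝ) ≤ D.card * K := by
    calc (U₂.card : ℝ)
        ≤ ∑ j ∈ D, ((Finset.univ.filter fun i : Fin N => dist (x' i) (x j) ≤ R).card : ℝ) := by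
          exact_mod_cast Finset.card_biUnion_le
      _ ≤ ∑ _j ∈ D, K := Finset.sum_le_sum fun j _ => by
          have h := card_filter_dist_le hδ hsep (x j) hR.le
          refine h.trans ?_
          rw [hK]
          gcongr
          linarith
      _ = D.card * K := by rw [Finset.sum_const, nsmul_eq_mul]
  -- assemble
  have hle : (badX.card : ℝ) ≤ badX'.card + D.card + U₁.card + U₂.card := by
    have h1 := Finset.card_le_card hcover
    have h2 := Finset.card_union_le (badX' ∪ D ∪ U₁) U₂
    have h3 := Finset.card_union_le (badX' ∪ D) U₁
    have h4 := Finset.card_union_le badX' D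
    have : badX.card ≤ badX'.card + D.card + U₁.card + U₂.card := by omega
    exact_mod_cast this
  rw [e1, e2]
  have hDnn : (0 : ℝ) ≤ D.card := Nat.cast_nonneg _
  calc (badX.card : ℝ) ≤ badX'.card + D.card + U₁.card + U₂.card := hle
    _ ≤ badX'.card + D.card + D.card * K + D.card * K := by linarith
    _ = badX'.card + (1 + 2 * K) * D.card := by ring
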